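import Literature.Probability.LatticeModels.TreeGraphWickPairing
import HarnessLib

/-!
# Deviation from Wick's law, tree-diagram form — IV: coincident points

Topic `Literature/Probability/LatticeModels`. `TreeGraphWickBound.lean` proves, for the random-current
ratios `W(A) = Z_K[A]/Z_K[∅]` of edge couplings `K ≥ 0` on a finite simple graph and every SET `B` of
vertices of even size, the tree-diagram form of Aizenman's bound on the deviation from Wick's law,
`|W(B) - 𝒢[W₂](B)| ≤ 2 ℛ[T,W₂](B)` (Aizenman 1982, Prop. 12.1 with the tree diagram bound Prop. 5.3;
Panis 2023, Prop. 4.6 with §4.2), and `TreeGraphWickPairing.lean` identifies the subset-indexed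
functionals with the tree's `pairingSum` / `wickRemainder` for INJECTIVE families of points. The
smeared moment bounds of the triviality theorems (Aizenman–Duminil-Copin 2021, §6.3; Panis 2023,
proof of Thm 5.5) sum over ALL `2n`-tuples of lattice points, coincidences included ("The cases with
coincidental points are easily reduced", Aizenman 1982, p. 37). This file performs that reduction:

* `oddSupp x B` — the set of vertices hit an odd number of times by the family `x` on the index set `B`
  (`∏_{i∈B} σ_{x i} = σ_{oddSupp x B}`; on `univ` it is the tree's `oddSupport`), with its calculus
  (`oddSupp_sdiff`, `oddSupp_erase`, `oddSupp_of_injOn`);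
* `TreeWickBounds W` — the four properties of a set functional `W` used by the greedy-pairing recursion:
  `W(∅) = 1`, `W ≥ 0`, the Gaussian step `W(B) ≤ ∑_{j} W({v}Δ{j}) W(B∖{v,j})` and the excess bound
  `∑_j W({m}Δ{j})W(B∖{m,j}) - W(B) ≤ 2 ∑_{|s|=3} T({m}∪s) W(B∖({m}∪s))`, `T(s) = ∑_u ∏_{i∈s} W({i}Δ{u})`
  — satisfied by the current ratios (`Current.treeWickBounds_ratio`, from `cratio_le_sum` and
  `gaussianExcess_cratio_le` of `TreeGraphWickBound`);
* `TreeWickBounds.abs_oddSupp_sub_fsPairing_le` — **the index-subset form for arbitrary families**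
  `x : ι → V`: `|W(oddSupp x B) - 𝒢[W₂ˣ](B)| ≤ 8 ℛ[Tˣ,W₂ˣ](B)` for every index set `B` of even size,
  `W₂ˣ(i,j) = W({x i}Δ{x j})`, `Tˣ(s) = ∑_u ∏_{i∈s} W({x i}Δ{u})`. The one-step excess bound for
  tuples (`TreeWickBounds.excess_tuple`, constant `8`) is reduced to the set-level one by a charging
  argument: an index `j` whose site is repeated at another index `j'` is charged, through the Gaussian
  step at `j'` (Newman) and the single tree term `u = x j'`, to the tree remainder; the indices of
  unrepeated sites are the terms of the set-level excess at the odd support, whose tree terms are pulled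
  back to index triples through representatives;
* `Current.abs_ratio_oddSupport_sub_pairingSum_le` — in the tree's vocabulary, for every
  `x : Fin (2n) → V` (coincidences allowed):
  `|W(oddSupport x) - 𝒢_n[W₂](x)| ≤ 8 · wickRemainder W₂ T n x`, `T(u) = ∑_v ∏_j W₂(u_j, v)`;
* `abs_nPoint_sub_pairingSum_le_univ_free`, `abs_nPoint_sub_pairingSum_le_box` — the same for the
  correlation functions of the free zero-field Ising model with uniform coupling `β ≥ 0` on a finite
  graph (`⟨∏σ_{xᵢ}⟩ = Z[oddSupport x]/Z[∅]`, random-current representation) and in a finite volume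
  `Λ ⊂ ℤ^d` (transport along the induced graph, as in `wickDeviation_le_box`):
  `|S_{2n}(x) - 𝒢_n[S₂](x)| ≤ 8 ∑_{|s|=4} (∑_{v∈Λ} ∏_{j∈s} ⟨σ_{x_j}σ_v⟩_Λ) 𝒢_{n-2}[S₂](x^{(s̸)})`.

## References

* M. Aizenman, Comm. Math. Phys. 86 (1982), Prop. 5.3, Prop. 12.1 (p. 37: "The cases with coincidental
  points are easily reduced") [AizenmanCMP1982].
* R. Panis, arXiv:2309.05797 (2023), Prop. 4.6, §4.2 [Panis2023Triviality].
* M. Aizenman, H. Duminil-Copin, Ann. of Math. 194 (2021), arXiv:1912.07973, §6.3 [AizenmanDuminilCopinAnnals2021].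

## Design

The constant `8` (instead of `2`) absorbs the multiplicity of the charging (each index triple is charged
at most `6 + 2` times); constants are immaterial downstream. No named fact is introduced.
-/

noncomputable section

open Finset
open scoped symmDiff

namespace Literature.Probability.LatticeModels

/-! ### The odd support of a family on an index subset -/

section OddSupp

variable {V : Type*} [Fintype V] [DecidableEq V] {ι : Type*}

/-- The set of vertices hit an odd number of times by the family `x` restricted to the index set `B`
(so that `∏_{i ∈ B} σ_{x i} = σ_{oddSupp x B}`; on `B = univ` this is `oddSupport x`). [folklore] -/
def oddSupp (x : ι → V) (B : Finset ι) : Finset V :=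
  univ.filter fun a => Odd (B.filter fun i => x i = a).card

/-- Membership in the odd support: the multiplicity of the site is odd. [folklore] -/
theorem mem_oddSupp {x : ι → V} {B : Finset ι} {a : V} :
    a ∈ oddSupp x B ↔ Odd (B.filter fun i => x i = a).card := by
  simp [oddSupp]

/-- On the full index set, `oddSupp` is the tree's `oddSupport`. [folklore] -/
theorem oddSupp_univ {m : ℕ} (x : Fin m → V) : oddSupp x univ = oddSupport x := rfl

/-- `oddSupp x ∅ = ∅`. [folklore] -/
theorem oddSupp_empty (x : ι → V) : oddSupp x (∅ : Finset ι) = ∅ := by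
  ext a
  simp [mem_oddSupp]

/-- A vertex of the odd support is hit by some index. [folklore] -/
theorem exists_mem_of_mem_oddSupp {x : ι → V} {B : Finset ι} {a : V} (ha : a ∈ oddSupp x B) :
    ∃ i ∈ B, x i = a := by
  have hne : (B.filter fun i => x i = a).Nonempty := by
    rw [← Finset.card_pos]
    exact (mem_oddSupp.1 ha).pos
  obtain ⟨i, hi⟩ := hne
  exact ⟨i, (Finset.mem_filter.1 hi).1, (Finset.mem_filter.1 hi).2⟩

/-- `oddSupp x {i} = {x i}`. [folklore] -/
theorem oddSupp_singleton (x : ι → V) (i : ι) : oddSupp x ({i} : Finset ι) = {x i} := by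
  ext a
  simp only [mem_oddSupp, Finset.filter_singleton, Finset.mem_singleton]
  split_ifs with h
  · simp [h]
  · simp only [Finset.card_empty, Nat.not_odd_zero, false_iff]
    exact fun h' => h h'.symm

variable [DecidableEq ι]

/-- **Removing indices**: `oddSupp x (B ∖ I) = oddSupp x B Δ oddSupp x I` for `I ⊆ B` (multiplicities
subtract, so parities add). [folklore] -/
theorem oddSupp_sdiff {x : ι → V} {B I : Finset ι} (h : I ⊆ B) :
    oddSupp x (B \ I) = oddSupp x B ∆ oddSupp x I := by
  ext a
  simp only [mem_oddSupp, Finset.mem_symmDiff]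
  have hcard : ((B \ I).filter fun i => x i = a).card + (I.filter fun i => x i = a).card =
      (B.filter fun i => x i = a).card := by
    rw [← Finset.card_union_of_disjoint (Finset.disjoint_filter_filter Finset.sdiff_disjoint)]
    congr 1
    ext i
    simp only [Finset.mem_union, Finset.mem_filter, Finset.mem_sdiff]
    constructor
    · rintro (⟨⟨hiB, -⟩, hx⟩ | ⟨hiI, hx⟩)
      · exact ⟨hiB, hx⟩
      · exact ⟨h hiI, hx⟩
    · rintro ⟨hiB, hx⟩
      by_cases hiI : i ∈ I
      · exact Or.inr ⟨hiI, hx⟩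
      · exact Or.inl ⟨⟨hiB, hiI⟩, hx⟩
  rw [← hcard, Nat.odd_add]
  rcases Nat.even_or_odd (I.filter fun i => x i = a).card with hq | hq
  · have hnq : ¬ Odd (I.filter fun i => x i = a).card := Nat.not_odd_iff_even.2 hq
    tauto
  · have hne : ¬ Even (I.filter fun i => x i = a).card := Nat.not_even_iff_odd.2 hq
    tauto

/-- Removing one index toggles its site: `oddSupp x (B ∖ i) = oddSupp x B Δ {x i}`. [folklore] -/
theorem oddSupp_erase {x : ι → V} {B : Finset ι} {i : ι} (hi : i ∈ B) :
    oddSupp x (B.erase i) = oddSupp x B ∆ {x i} := by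
  rw [← Finset.sdiff_singleton_eq_erase, oddSupp_sdiff (Finset.singleton_subset_iff.2 hi),
    oddSupp_singleton]

/-- Removing two indices toggles both sites. [folklore] -/
theorem oddSupp_erase_erase {x : ι → V} {B : Finset ι} {i j : ι} (hi : i ∈ B) (hj : j ∈ B)
    (hij : i ≠ j) : oddSupp x ((B.erase i).erase j) = oddSupp x B ∆ {x i} ∆ {x j} := by
  rw [oddSupp_erase (Finset.mem_erase.2 ⟨hij.symm, hj⟩), oddSupp_erase hi]

/-- Removing two indices carrying the same site does not change the odd support. [folklore] -/
theorem oddSupp_erase_erase_of_eq {x : ι → V} {B : Finset ι} {i j : ι} (hi : i ∈ B) (hj : j ∈ B)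
    (hij : i ≠ j) (hx : x i = x j) : oddSupp x ((B.erase i).erase j) = oddSupp x B := by
  rw [oddSupp_erase_erase hi hj hij, hx, symmDiff_symmDiff_cancel_right]

omit [DecidableEq ι] in
/-- On an index set where `x` is injective every site has multiplicity one:
`oddSupp x I = x(I)`. [folklore] -/
theorem oddSupp_of_injOn {x : ι → V} {I : Finset ι} (h : Set.InjOn x I) :
    oddSupp x I = I.image x := by
  ext a
  simp only [mem_oddSupp, Finset.mem_image]
  constructor
  · intro hodd
    have hne : (I.filter fun i => x i = a).Nonempty := by
      rw [← Finset.card_pos]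
      exact hodd.pos
    obtain ⟨i, hi⟩ := hne
    exact ⟨i, (Finset.mem_filter.1 hi).1, (Finset.mem_filter.1 hi).2⟩
  · rintro ⟨i, hi, rfl⟩
    have : I.filter (fun j => x j = x i) = {i} := by
      ext j
      simp only [Finset.mem_filter, Finset.mem_singleton]
      constructor
      · exact fun hj => h hj.1 hi hj.2
      · rintro rfl
        exact ⟨hi, rfl⟩
    rw [this, Finset.card_singleton]
    exact odd_one

omit [Fintype V] [DecidableEq ι] in
/-- `s Δ {a} = s ∖ a` for `a ∈ s`. [folklore] -/
theorem symmDiff_singleton_eq_erase {s : Finset V} {a : V} (h : a ∈ s) : s ∆ {a} = s.erase a := by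
  rw [symmDiff_of_ge (Finset.singleton_subset_iff.2 h), Finset.sdiff_singleton_eq_erase]

end OddSupp

/-! ### The greedy-pairing hypotheses for a set functional and the tuple functionals -/

section Abstract

variable {V : Type*} [Fintype V] [DecidableEq V]

/-- **The inputs of the greedy-pairing recursion**, as properties of a real functional `W` on vertex
sets (the correlation `A ↦ ⟨σ_A⟩` of a ferromagnetic state; for random-current ratios these are
`cratio_empty`, `cratio_nonneg`, the Gaussian step `cratio_le_sum` (one switching) and the excess
bound `gaussianExcess_cratio_le` of `TreeGraphWickBound`): `W(∅) = 1`, `W ≥ 0`,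
`W(B) ≤ ∑_{j ∈ B∖v} W({v}Δ{j}) W(B∖{v,j})` and
`∑_{j∈B∖m} W({m}Δ{j}) W(B∖{m,j}) - W(B) ≤ 2 ∑_{s ⊆ B∖m, |s|=3} (∑_u ∏_{i ∈ {m}∪s} W({i}Δ{u})) W(B∖({m}∪s))`.
[cite: AizenmanCMP1982, Prop. 12.1 with Prop. 5.3] [cite: Panis2023Triviality, Prop. 4.6 and §4.2] -/
structure TreeWickBounds (W : Finset V → ℝ) : Prop where
  /-- `W(∅) = 1`. -/
  empty : W ∅ = 1
  /-- `W ≥ 0` (Griffiths I). -/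
  nonneg : ∀ A, 0 ≤ W A
  /-- The Gaussian step (Newman; one switching). -/
  step : ∀ (B : Finset V) (v : V), v ∈ B →
    W B ≤ ∑ j ∈ B.erase v, W ({v} ∆ {j}) * W ((B.erase v).erase j)
  /-- The excess of the Gaussian step is bounded by tree diagrams. -/
  excess : ∀ (B : Finset V) (m : V), m ∈ B →
    ∑ j ∈ B.erase m, W ({m} ∆ {j}) * W ((B.erase m).erase j) - W B ≤
      2 * ∑ s ∈ (B.erase m).powersetCard 3,
        (∑ u, ∏ i ∈ insert m s, W ({i} ∆ {u})) * W (B \ insert m s)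

variable {ι : Type*}

/-- The two-point matrix of a family in index coordinates, `W₂ˣ(i,j) = W({x i}Δ{x j})`
(`= 1` when `x i = x j`). [folklore] -/
def tupleTwo (W : Finset V → ℝ) (x : ι → V) (i j : ι) : ℝ := W ({x i} ∆ {x j})

/-- Aizenman's tree diagram of a family on an index set, `Tˣ(s) = ∑_u ∏_{i∈s} W({x i}Δ{u})`.
[cite: AizenmanCDM2020, Lemma 8.1, eq. (8.2)] -/
def tupleTree (W : Finset V → ℝ) (x : ι → V) (s : Finset ι) : ℝ := ∑ u, ∏ i ∈ s, W ({x i} ∆ {u})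

variable {W : Finset V → ℝ}

/-- `W₂ˣ` is symmetric. [folklore] -/
theorem tupleTwo_comm (W : Finset V → ℝ) (x : ι → V) (i j : ι) :
    tupleTwo W x i j = tupleTwo W x j i := by
  rw [tupleTwo, tupleTwo, symmDiff_comm]

/-- `W₂ˣ ≥ 0`. [folklore] -/
theorem tupleTwo_nonneg (h : TreeWickBounds W) (x : ι → V) (i j : ι) : 0 ≤ tupleTwo W x i j :=
  h.nonneg _

/-- `Tˣ ≥ 0`. [folklore] -/
theorem tupleTree_nonneg (h : TreeWickBounds W) (x : ι → V) (s : Finset ι) : 0 ≤ tupleTree W x s :=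
  Finset.sum_nonneg fun _ _ => Finset.prod_nonneg fun _ _ => h.nonneg _

/-- Coincident sites have `W₂ˣ(i,j) = W(∅) = 1` (`σ_a² = 1`). [folklore] -/
theorem tupleTwo_of_eq (h : TreeWickBounds W) (x : ι → V) {i j : ι} (hx : x i = x j) :
    tupleTwo W x i j = 1 := by
  rw [tupleTwo, hx, symmDiff_self, Finset.bot_eq_empty, h.empty]

/-- **The Gaussian step for families with repetitions** (Newman's one-switching inequality at an
arbitrary index `q`): `W(oddSupp x B) ≤ ∑_{k ∈ B∖q} W₂ˣ(q,k) W(oddSupp x (B∖{q,k}))`. If the site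
`x q` has odd multiplicity, this is the set-level step at `x q` restricted to one representative index
per site; if it is even, another index `q'` carries the same site and the single term `k = q'` already
equals the left side. [cite: AizenmanDuminilCopinAnnals2021, arXiv:1912.07973 §6.3, first display, lower inequality (p. 26)] -/
theorem TreeWickBounds.oddSupp_le_sum [DecidableEq ι] (h : TreeWickBounds W) (x : ι → V)
    {B : Finset ι} {q : ι} (hq : q ∈ B) :
    W (oddSupp x B) ≤ ∑ k ∈ B.erase q, tupleTwo W x q k * W (oddSupp x ((B.erase q).erase k)) := by
  have hG0 : ∀ k, 0 ≤ tupleTwo W x q k * W (oddSupp x ((B.erase q).erase k)) := fun k =>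
    mul_nonneg (h.nonneg _) (h.nonneg _)
  by_cases ha : x q ∈ oddSupp x B
  · -- one representative index for each site of the odd support
    have hrep : ∀ b ∈ (oddSupp x B).erase (x q), ∃ k ∈ B.erase q, x k = b := by
      intro b hb
      obtain ⟨k, hkB, hk⟩ := exists_mem_of_mem_oddSupp (Finset.mem_of_mem_erase hb)
      refine ⟨k, Finset.mem_erase.2 ⟨?_, hkB⟩, hk⟩
      rintro rfl
      exact Finset.ne_of_mem_erase hb hk.symm
    haveI : Nonempty ι := ⟨q⟩
    choose! k hk using hrep
    calc W (oddSupp x B)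
        ≤ ∑ b ∈ (oddSupp x B).erase (x q),
            W ({x q} ∆ {b}) * W (((oddSupp x B).erase (x q)).erase b) := h.step _ _ ha
      _ = ∑ b ∈ (oddSupp x B).erase (x q),
            tupleTwo W x q (k b) * W (oddSupp x ((B.erase q).erase (k b))) := by
          refine Finset.sum_congr rfl fun b hb => ?_
          obtain ⟨hkb, hxk⟩ := hk b hb
          have hkbB : k b ∈ B := Finset.mem_of_mem_erase hkb
          have hkq : k b ≠ q := Finset.ne_of_mem_erase hkb
          rw [tupleTwo, oddSupp_erase_erase hq hkbB hkq.symm, hxk, symmDiff_singleton_eq_erase ha,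
            symmDiff_singleton_eq_erase hb]
      _ = ∑ k' ∈ ((oddSupp x B).erase (x q)).image k,
            tupleTwo W x q k' * W (oddSupp x ((B.erase q).erase k')) := by
          rw [Finset.sum_image]
          intro b hb b' hb' hkk
          rw [← (hk b hb).2, ← (hk b' hb').2, hkk]
      _ ≤ ∑ k' ∈ B.erase q, tupleTwo W x q k' * W (oddSupp x ((B.erase q).erase k')) := by
          refine Finset.sum_le_sum_of_subset_of_nonneg (fun k' hk' => ?_) fun k' _ _ => hG0 k'
          obtain ⟨b, hb, rfl⟩ := Finset.mem_image.1 hk'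
          exact (hk b hb).1
  · -- the multiplicity of `x q` is even and positive: another index carries the same site
    have hF : q ∈ B.filter (fun i => x i = x q) := Finset.mem_filter.2 ⟨hq, rfl⟩
    have heven : Even (B.filter fun i => x i = x q).card := by
      rcases Nat.even_or_odd (B.filter fun i => x i = x q).card with he | ho
      · exact he
      · exact absurd (mem_oddSupp.2 ho) ha
    have h2 : 2 ≤ (B.filter fun i => x i = x q).card := by
      have h1 : 1 ≤ (B.filter fun i => x i = x q).card := Finset.card_pos.2 ⟨q, hF⟩
      obtain ⟨t, ht⟩ := heven
      omega
    obtain ⟨q', hq'⟩ : ((B.filter fun i => x i = x q).erase q).Nonempty := by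
      rw [← Finset.card_pos, Finset.card_erase_of_mem hF]
      omega
    have hq'q : q' ≠ q := Finset.ne_of_mem_erase hq'
    have hq'B : q' ∈ B := (Finset.mem_filter.1 (Finset.mem_of_mem_erase hq')).1
    have hxq' : x q' = x q := (Finset.mem_filter.1 (Finset.mem_of_mem_erase hq')).2
    have hterm : tupleTwo W x q q' * W (oddSupp x ((B.erase q).erase q')) = W (oddSupp x B) := by
      rw [tupleTwo_of_eq h x hxq'.symm, one_mul, oddSupp_erase_erase_of_eq hq hq'B hq'q.symm hxq'.symm]
    rw [← hterm]
    exact Finset.single_le_sum (f := fun k => tupleTwo W x q k * W (oddSupp x ((B.erase q).erase k)))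
      (fun k _ => hG0 k) (Finset.mem_erase.2 ⟨hq'q, hq'B⟩)

variable [LinearOrder ι]

/-- **Newman's Gaussian inequality for families with repetitions**: `W(oddSupp x B) ≤ 𝒢[W₂ˣ](B)`
for `|B|` even (greedy recursion `le_fsPairing_of_step`). [cite: AizenmanDuminilCopinAnnals2021, arXiv:1912.07973 §6.3, first display, lower inequality (p. 26)] -/
theorem TreeWickBounds.oddSupp_le_fsPairing (h : TreeWickBounds W) (x : ι → V) {B : Finset ι}
    (hB : Even B.card) : W (oddSupp x B) ≤ fsPairing (tupleTwo W x) B :=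
  le_fsPairing_of_step (S₂ := tupleTwo W x) (S := fun B => W (oddSupp x B))
    (fun _ _ => h.nonneg _) (le_of_eq (by show W (oddSupp x ∅) = 1; rw [oddSupp_empty, h.empty]))
    (fun B hB _ => h.oddSupp_le_sum x (B.min'_mem hB)) B hB

/-- **Charging a repeated site.** If `j' ∈ B ∖ {m, j}` carries the site of `m` or of `j`, then
`W₂ˣ(m,j) W(oddSupp x (B∖{m,j})) ≤ ∑_{k} Tˣ({m,j,j',k}) 𝒢[W₂ˣ](B∖{m,j,j',k})`: apply the Gaussian step
at `j'`, and bound `W₂ˣ(m,j) W₂ˣ(j',k)` by the single term `u = x j'` of the tree diagram (the two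
other factors are `W(∅) = 1`), and the remaining correlation by Newman's inequality. [folklore] -/
theorem TreeWickBounds.charge (h : TreeWickBounds W) (x : ι → V) {B : Finset ι} (hB : Even B.card)
    {m j j' : ι} (hm : m ∈ B) (hj : j ∈ B.erase m) (hj' : j' ∈ (B.erase m).erase j)
    (hx : x j' = x m ∨ x j' = x j) :
    tupleTwo W x m j * W (oddSupp x ((B.erase m).erase j)) ≤
      ∑ k ∈ ((B.erase m).erase j).erase j',
        tupleTree W x {m, j, j', k} * fsPairing (tupleTwo W x) (B \ {m, j, j', k}) := by
  have hjm : j ≠ m := Finset.ne_of_mem_erase hj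
  have hjB : j ∈ B := Finset.mem_of_mem_erase hj
  have hj'j : j' ≠ j := Finset.ne_of_mem_erase hj'
  have hj'm : j' ≠ m := Finset.ne_of_mem_erase (Finset.mem_of_mem_erase hj')
  have hc0 : 0 ≤ tupleTwo W x m j := h.nonneg _
  have hstep := h.oddSupp_le_sum x (B := (B.erase m).erase j) hj'
  refine (mul_le_mul_of_nonneg_left hstep hc0).trans ?_
  rw [Finset.mul_sum]
  refine Finset.sum_le_sum fun k hk => ?_
  have hkj' : k ≠ j' := Finset.ne_of_mem_erase hk
  have hk2 : k ∈ (B.erase m).erase j := Finset.mem_of_mem_erase hk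
  have hkj : k ≠ j := Finset.ne_of_mem_erase hk2
  have hkm : k ≠ m := Finset.ne_of_mem_erase (Finset.mem_of_mem_erase hk2)
  have hkB : k ∈ B := Finset.mem_of_mem_erase (Finset.mem_of_mem_erase hk2)
  -- the coupling factors against the single tree term `u = x j'`
  have hα : tupleTwo W x m j * tupleTwo W x j' k ≤ tupleTree W x {m, j, j', k} := by
    have hmem : ¬ (m ∈ ({j, j', k} : Finset ι)) := by
      simp only [Finset.mem_insert, Finset.mem_singleton, not_or]
      exact ⟨hjm.symm, hj'm.symm, hkm.symm⟩
    have hmem' : ¬ (j ∈ ({j', k} : Finset ι)) := by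
      simp only [Finset.mem_insert, Finset.mem_singleton, not_or]
      exact ⟨hj'j.symm, hkj.symm⟩
    have hmem'' : ¬ (j' ∈ ({k} : Finset ι)) := by
      simp only [Finset.mem_singleton]
      exact hkj'.symm
    have hsingle : ∏ i ∈ ({m, j, j', k} : Finset ι), W ({x i} ∆ {x j'}) ≤ tupleTree W x {m, j, j', k} :=
      Finset.single_le_sum (f := fun u => ∏ i ∈ ({m, j, j', k} : Finset ι), W ({x i} ∆ {u}))
        (fun u _ => Finset.prod_nonneg fun i _ => h.nonneg _) (Finset.mem_univ (x j'))
    refine le_trans (le_of_eq ?_) hsingle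
    rw [Finset.prod_insert hmem, Finset.prod_insert hmem', Finset.prod_insert hmem'',
      Finset.prod_singleton, symmDiff_self, Finset.bot_eq_empty, h.empty, tupleTwo, tupleTwo]
    rcases hx with hx | hx
    · rw [hx, symmDiff_self, Finset.bot_eq_empty, h.empty, symmDiff_comm {x j} {x m},
        symmDiff_comm {x k} {x m}]
      ring
    · rw [hx, symmDiff_self, Finset.bot_eq_empty, h.empty, symmDiff_comm {x k} {x j}]
      ring
  -- the remaining correlation by Newman's inequality
  have hsub : ({m, j, j', k} : Finset ι) ⊆ B := by
    intro w hw
    simp only [Finset.mem_insert, Finset.mem_singleton] at hw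
    rcases hw with rfl | rfl | rfl | rfl
    · exact hm
    · exact hjB
    · exact Finset.mem_of_mem_erase (Finset.mem_of_mem_erase hj')
    · exact hkB
  have hcard4 : ({m, j, j', k} : Finset ι).card = 4 := by
    have hmem : ¬ (m ∈ ({j, j', k} : Finset ι)) := by
      simp only [Finset.mem_insert, Finset.mem_singleton, not_or]
      exact ⟨hjm.symm, hj'm.symm, hkm.symm⟩
    have hmem' : ¬ (j ∈ ({j', k} : Finset ι)) := by
      simp only [Finset.mem_insert, Finset.mem_singleton, not_or]
      exact ⟨hj'j.symm, hkj.symm⟩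
    have hmem'' : ¬ (j' ∈ ({k} : Finset ι)) := by
      simp only [Finset.mem_singleton]
      exact hkj'.symm
    rw [Finset.card_insert_of_notMem hmem, Finset.card_insert_of_notMem hmem',
      Finset.card_insert_of_notMem hmem'', Finset.card_singleton]
  have hβ : W (oddSupp x ((((B.erase m).erase j).erase j').erase k)) ≤
      fsPairing (tupleTwo W x) (B \ {m, j, j', k}) := by
    have hset : (((B.erase m).erase j).erase j').erase k = B \ {m, j, j', k} := by
      ext w
      simp only [Finset.mem_erase, Finset.mem_sdiff, Finset.mem_insert, Finset.mem_singleton]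
      tauto
    rw [hset]
    refine h.oddSupp_le_fsPairing x ?_
    rw [Finset.card_sdiff_of_subset hsub, hcard4]
    exact (Nat.even_sub (hcard4 ▸ Finset.card_le_card hsub)).2 (iff_of_true hB (by decide))
  calc tupleTwo W x m j * (tupleTwo W x j' k * W (oddSupp x ((((B.erase m).erase j).erase j').erase k)))
      = (tupleTwo W x m j * tupleTwo W x j' k) *
          W (oddSupp x ((((B.erase m).erase j).erase j').erase k)) := by ring
    _ ≤ tupleTree W x {m, j, j', k} * W (oddSupp x ((((B.erase m).erase j).erase j').erase k)) :=
        mul_le_mul_of_nonneg_right hα (h.nonneg _)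
    _ ≤ tupleTree W x {m, j, j', k} * fsPairing (tupleTwo W x) (B \ {m, j, j', k}) :=
        mul_le_mul_of_nonneg_left hβ (tupleTree_nonneg h x _)

/-- **The one-step excess bound for families with repetitions** (constant `8`): for `|B|` even and
`m ∈ B`,
`∑_{j∈B∖m} W₂ˣ(m,j) W(oddSupp x (B∖{m,j})) - W(oddSupp x B) ≤ 8 ∑_{s⊆B∖m,|s|=3} Tˣ({m}∪s) 𝒢[W₂ˣ](B∖({m}∪s))`.
If the site `x m` is repeated at `q`, the term `j = q` equals `W(oddSupp x B)` and every other index is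
charged at `q` (`charge`); otherwise the indices whose site is repeated are charged at a partner, and the
indices of unrepeated sites are terms of the set-level excess at the odd support
(`TreeWickBounds.excess`), whose tree terms are pulled back along representatives.
[cite: AizenmanCMP1982, Prop. 12.1 (p. 37, "The cases with coincidental points are easily reduced")] -/
theorem TreeWickBounds.excess_tuple (h : TreeWickBounds W) (x : ι → V) {B : Finset ι} (hB : Even B.card)
    {m : ι} (hm : m ∈ B) :
    ∑ j ∈ B.erase m, tupleTwo W x m j * W (oddSupp x ((B.erase m).erase j)) - W (oddSupp x B) ≤
      8 * ∑ s ∈ (B.erase m).powersetCard 3,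
        tupleTree W x (insert m s) * fsPairing (tupleTwo W x) (B \ insert m s) := by
  -- notation
  set S : Finset ι := B.erase m with hS
  set φ : Finset ι → ℝ := fun s => tupleTree W x (insert m s) * fsPairing (tupleTwo W x) (B \ insert m s)
    with hφ
  set R : ℝ := ∑ s ∈ S.powersetCard 3, φ s with hR
  set term : ι → ℝ := fun j => tupleTwo W x m j * W (oddSupp x (S.erase j)) with hterm
  have hφ0 : ∀ s, 0 ≤ φ s := fun s =>
    mul_nonneg (tupleTree_nonneg h x _) (fsPairing_nonneg (fun _ _ => h.nonneg _) _)
  have hR0 : 0 ≤ R := Finset.sum_nonneg fun s _ => hφ0 s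
  have hterm0 : ∀ j, 0 ≤ term j := fun j => mul_nonneg (h.nonneg _) (h.nonneg _)
  show ∑ j ∈ S, term j - W (oddSupp x B) ≤ 8 * R
  -- the triple sum over ordered triples is `6 R`
  have h6 : ∑ j ∈ S, ∑ j'' ∈ S.erase j, ∑ k ∈ (S.erase j).erase j'', φ {j, j'', k} = 6 * R := by
    rw [sum_sum_sum_erase_eq_six_nsmul S φ, nsmul_eq_mul, ← hR]
    norm_num
  have h3_0 : ∀ j, 0 ≤ ∑ j'' ∈ S.erase j, ∑ k ∈ (S.erase j).erase j'', φ {j, j'', k} := fun j =>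
    Finset.sum_nonneg fun _ _ => Finset.sum_nonneg fun _ _ => hφ0 _
  -- charging an index at a partner carrying the site of `m` or of the index
  have hcharge : ∀ j ∈ S, ∀ j' ∈ S.erase j, (x j' = x m ∨ x j' = x j) →
      term j ≤ ∑ j'' ∈ S.erase j, ∑ k ∈ (S.erase j).erase j'', φ {j, j'', k} := by
    intro j hj j' hj' hx
    calc term j ≤ ∑ k ∈ (S.erase j).erase j', φ {j, j', k} := h.charge x hB hm hj hj' hx
      _ ≤ ∑ j'' ∈ S.erase j, ∑ k ∈ (S.erase j).erase j'', φ {j, j'', k} :=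
          Finset.single_le_sum (f := fun j'' => ∑ k ∈ (S.erase j).erase j'', φ {j, j'', k})
            (fun j'' _ => Finset.sum_nonneg fun k _ => hφ0 _) hj'
  by_cases hrep : ∃ q ∈ S, x q = x m
  · -- Case 1: the site of `m` is repeated at `q`
    obtain ⟨q, hqS, hxq⟩ := hrep
    have hqB : q ∈ B := Finset.mem_of_mem_erase hqS
    have hqm : q ≠ m := Finset.ne_of_mem_erase hqS
    have htq : term q = W (oddSupp x B) := by
      show tupleTwo W x m q * W (oddSupp x (S.erase q)) = W (oddSupp x B)
      rw [tupleTwo_of_eq h x hxq.symm, one_mul, hS, oddSupp_erase_erase_of_eq hm hqB hqm.symm hxq.symm]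
    rw [← Finset.add_sum_erase S term hqS, htq]
    have hsum : ∑ j ∈ S.erase q, term j ≤ 6 * R := by
      calc ∑ j ∈ S.erase q, term j
          ≤ ∑ j ∈ S.erase q, ∑ j'' ∈ S.erase j, ∑ k ∈ (S.erase j).erase j'', φ {j, j'', k} := by
            refine Finset.sum_le_sum fun j hj => ?_
            have hjq : j ≠ q := Finset.ne_of_mem_erase hj
            exact hcharge j (Finset.mem_of_mem_erase hj) q (Finset.mem_erase.2 ⟨hjq.symm, hqS⟩)
              (Or.inl hxq)
        _ ≤ ∑ j ∈ S, ∑ j'' ∈ S.erase j, ∑ k ∈ (S.erase j).erase j'', φ {j, j'', k} :=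
            Finset.sum_le_sum_of_subset_of_nonneg (Finset.erase_subset _ _) fun j _ _ => h3_0 j
        _ = 6 * R := h6
    linarith
  · -- Case 2: the site of `m` has multiplicity one
    push Not at hrep
    have haY : x m ∈ oddSupp x B := by
      rw [mem_oddSupp]
      have hfil : B.filter (fun i => x i = x m) = {m} := by
        ext i
        simp only [Finset.mem_filter, Finset.mem_singleton]
        constructor
        · rintro ⟨hiB, hxi⟩
          by_contra him
          exact hrep i (Finset.mem_erase.2 ⟨him, hiB⟩) hxi
        · rintro rfl
          exact ⟨hm, rfl⟩
      rw [hfil, Finset.card_singleton]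
      exact odd_one
    -- (a) indices whose site is repeated are charged at a partner
    have hCsum : ∑ j ∈ S.filter (fun j => ∃ j' ∈ S.erase j, x j' = x j), term j ≤ 6 * R := by
      calc ∑ j ∈ S.filter (fun j => ∃ j' ∈ S.erase j, x j' = x j), term j
          ≤ ∑ j ∈ S.filter (fun j => ∃ j' ∈ S.erase j, x j' = x j),
              ∑ j'' ∈ S.erase j, ∑ k ∈ (S.erase j).erase j'', φ {j, j'', k} := by
            refine Finset.sum_le_sum fun j hj => ?_
            obtain ⟨hjS, j', hj', hxj'⟩ := Finset.mem_filter.1 hj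
            exact hcharge j hjS j' hj' (Or.inr hxj')
        _ ≤ ∑ j ∈ S, ∑ j'' ∈ S.erase j, ∑ k ∈ (S.erase j).erase j'', φ {j, j'', k} :=
            Finset.sum_le_sum_of_subset_of_nonneg (Finset.filter_subset _ _) fun j _ _ => h3_0 j
        _ = 6 * R := h6
    -- (b) indices of unrepeated sites are terms of the set-level excess at the odd support
    have hNsum : ∑ j ∈ S.filter (fun j => ¬ ∃ j' ∈ S.erase j, x j' = x j), term j ≤
        ∑ b ∈ (oddSupp x B).erase (x m),
          W ({x m} ∆ {b}) * W (((oddSupp x B).erase (x m)).erase b) := by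
      set N := S.filter (fun j => ¬ ∃ j' ∈ S.erase j, x j' = x j) with hN
      have hNprop : ∀ j ∈ N, j ∈ S ∧ ∀ j' ∈ S.erase j, x j' ≠ x j := by
        intro j hj
        obtain ⟨hjS, hno⟩ := Finset.mem_filter.1 hj
        exact ⟨hjS, fun j' hj' hxx => hno ⟨j', hj', hxx⟩⟩
      have hxY : ∀ j ∈ N, x j ∈ (oddSupp x B).erase (x m) := by
        intro j hj
        obtain ⟨hjS, hno⟩ := hNprop j hj
        have hjB : j ∈ B := Finset.mem_of_mem_erase hjS
        refine Finset.mem_erase.2 ⟨hrep j hjS, ?_⟩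
        rw [mem_oddSupp]
        have hfil : B.filter (fun i => x i = x j) = {j} := by
          ext i
          simp only [Finset.mem_filter, Finset.mem_singleton]
          constructor
          · rintro ⟨hiB, hxi⟩
            by_contra hij
            by_cases him : i = m
            · exact hrep j hjS (by rw [← hxi, him])
            · exact hno i (Finset.mem_erase.2 ⟨hij, Finset.mem_erase.2 ⟨him, hiB⟩⟩) hxi
          · rintro rfl
            exact ⟨hjB, rfl⟩
        rw [hfil, Finset.card_singleton]
        exact odd_one
      have hterm_eq : ∀ j ∈ N, term j =
          W ({x m} ∆ {x j}) * W (((oddSupp x B).erase (x m)).erase (x j)) := by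
        intro j hj
        obtain ⟨hjS, -⟩ := hNprop j hj
        have hjm : j ≠ m := Finset.ne_of_mem_erase hjS
        have hjB : j ∈ B := Finset.mem_of_mem_erase hjS
        show tupleTwo W x m j * W (oddSupp x (S.erase j)) = _
        rw [tupleTwo, hS, oddSupp_erase_erase hm hjB hjm.symm, symmDiff_singleton_eq_erase haY,
          symmDiff_singleton_eq_erase (hxY j hj)]
      have hinj : Set.InjOn x N := by
        intro j₁ hj₁ j₂ hj₂ hx12
        by_contra hne
        obtain ⟨-, hno⟩ := hNprop j₁ (Finset.mem_coe.1 hj₁)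
        exact hno j₂ (Finset.mem_erase.2 ⟨Ne.symm hne, (hNprop j₂ (Finset.mem_coe.1 hj₂)).1⟩) hx12.symm
      calc ∑ j ∈ N, term j
          = ∑ j ∈ N, W ({x m} ∆ {x j}) * W (((oddSupp x B).erase (x m)).erase (x j)) :=
            Finset.sum_congr rfl hterm_eq
        _ = ∑ b ∈ N.image x, W ({x m} ∆ {b}) * W (((oddSupp x B).erase (x m)).erase b) :=
            (Finset.sum_image (f := fun b => W ({x m} ∆ {b}) * W (((oddSupp x B).erase (x m)).erase b))
              hinj).symm
        _ ≤ ∑ b ∈ (oddSupp x B).erase (x m),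
              W ({x m} ∆ {b}) * W (((oddSupp x B).erase (x m)).erase b) := by
            refine Finset.sum_le_sum_of_subset_of_nonneg (fun b hb => ?_)
              fun b _ _ => mul_nonneg (h.nonneg _) (h.nonneg _)
            obtain ⟨j, hj, rfl⟩ := Finset.mem_image.1 hb
            exact hxY j hj
    -- (c) the set-level excess bound at the odd support
    have hexc := h.excess (oddSupp x B) (x m) haY
    -- (d) its tree terms are tree terms of index triples (representatives)
    have hrepsum : ∑ t ∈ ((oddSupp x B).erase (x m)).powersetCard 3,
        (∑ u, ∏ i ∈ insert (x m) t, W ({i} ∆ {u})) * W (oddSupp x B \ insert (x m) t) ≤ R := by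
      have hrep' : ∀ b ∈ oddSupp x B, ∃ i ∈ B, x i = b := fun b hb => exists_mem_of_mem_oddSupp hb
      haveI : Nonempty ι := ⟨m⟩
      choose! rep hrepB hrepx using hrep'
      have hinjY : ∀ b₁ ∈ oddSupp x B, ∀ b₂ ∈ oddSupp x B, rep b₁ = rep b₂ → b₁ = b₂ :=
        fun b₁ h₁ b₂ h₂ he => by rw [← hrepx b₁ h₁, ← hrepx b₂ h₂, he]
      have hrepS : ∀ b ∈ (oddSupp x B).erase (x m), rep b ∈ S := by
        intro b hb
        have hbY := Finset.mem_of_mem_erase hb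
        refine Finset.mem_erase.2 ⟨?_, hrepB b hbY⟩
        intro hbm
        exact Finset.ne_of_mem_erase hb (by rw [← hrepx b hbY, hbm])
      have hkey : ∀ t : Finset V, (∀ b ∈ t, b ∈ oddSupp x B) → (t.image rep).image x = t := by
        intro t ht
        rw [Finset.image_image, Finset.image_congr (show Set.EqOn (x ∘ rep) id ↑t from
          fun b hb => hrepx b (ht b hb))]
        exact Finset.image_id
      -- termwise
      have hle : ∀ t ∈ ((oddSupp x B).erase (x m)).powersetCard 3,
          (∑ u, ∏ i ∈ insert (x m) t, W ({i} ∆ {u})) * W (oddSupp x B \ insert (x m) t) ≤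
            φ (t.image rep) := by
        intro t ht
        obtain ⟨htY, htcard⟩ := Finset.mem_powersetCard.1 ht
        have htY' : ∀ b ∈ t, b ∈ oddSupp x B := fun b hb => Finset.mem_of_mem_erase (htY hb)
        have hxm_t : x m ∉ t := fun h' => Finset.notMem_erase _ _ (htY h')
        have hm_s : m ∉ t.image rep := by
          intro h'
          obtain ⟨b, hb, hbm⟩ := Finset.mem_image.1 h'
          exact Finset.ne_of_mem_erase (hrepS b (htY hb)) hbm
        have hinj_t : Set.InjOn rep ↑t := fun b₁ h₁ b₂ h₂ he =>
          hinjY b₁ (htY' b₁ h₁) b₂ (htY' b₂ h₂) he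
        have hsub : insert m (t.image rep) ⊆ B := by
          refine Finset.insert_subset hm fun i hi => ?_
          obtain ⟨b, hb, rfl⟩ := Finset.mem_image.1 hi
          exact hrepB b (htY' b hb)
        -- the tree diagrams coincide
        have htree : tupleTree W x (insert m (t.image rep)) =
            ∑ u, ∏ i ∈ insert (x m) t, W ({i} ∆ {u}) := by
          unfold tupleTree
          refine Finset.sum_congr rfl fun u _ => ?_
          rw [Finset.prod_insert hm_s, Finset.prod_insert hxm_t, Finset.prod_image hinj_t]
          congr 1
          exact Finset.prod_congr rfl fun b hb => by rw [hrepx b (htY' b hb)]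
        -- the odd support of the remaining indices
        have hodd : oddSupp x (B \ insert m (t.image rep)) = oddSupp x B \ insert (x m) t := by
          rw [oddSupp_sdiff hsub]
          have hinjI : Set.InjOn x ↑(insert m (t.image rep)) := by
            intro i₁ hi₁ i₂ hi₂ he
            rw [Finset.coe_insert, Set.mem_insert_iff] at hi₁ hi₂
            have hval : ∀ i, i ∈ (↑(t.image rep) : Set ι) → ∃ b ∈ t, rep b = i := fun i hi => by
              simpa using hi
            rcases hi₁ with rfl | hi₁ <;> rcases hi₂ with rfl | hi₂
            · rfl
            · obtain ⟨b, hb, rfl⟩ := hval _ hi₂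
              rw [hrepx b (htY' b hb)] at he
              exact absurd he.symm (Finset.ne_of_mem_erase (htY hb))
            · obtain ⟨b, hb, rfl⟩ := hval _ hi₁
              rw [hrepx b (htY' b hb)] at he
              exact absurd he (Finset.ne_of_mem_erase (htY hb))
            · obtain ⟨b₁, hb₁, rfl⟩ := hval _ hi₁
              obtain ⟨b₂, hb₂, rfl⟩ := hval _ hi₂
              rw [hrepx b₁ (htY' b₁ hb₁), hrepx b₂ (htY' b₂ hb₂)] at he
              rw [he]
          rw [oddSupp_of_injOn hinjI, Finset.image_insert, hkey t htY']
          exact symmDiff_of_ge (Finset.insert_subset haY fun b hb => htY' b hb)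
        have hWle : W (oddSupp x B \ insert (x m) t) ≤
            fsPairing (tupleTwo W x) (B \ insert m (t.image rep)) := by
          rw [← hodd]
          refine h.oddSupp_le_fsPairing x ?_
          have hcardI : (insert m (t.image rep)).card = 4 := by
            rw [Finset.card_insert_of_notMem hm_s, Finset.card_image_of_injOn hinj_t, htcard]
          rw [Finset.card_sdiff_of_subset hsub, hcardI]
          exact (Nat.even_sub (hcardI ▸ Finset.card_le_card hsub)).2 (iff_of_true hB (by decide))
        calc (∑ u, ∏ i ∈ insert (x m) t, W ({i} ∆ {u})) * W (oddSupp x B \ insert (x m) t)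
            = tupleTree W x (insert m (t.image rep)) * W (oddSupp x B \ insert (x m) t) := by
              rw [htree]
          _ ≤ tupleTree W x (insert m (t.image rep)) *
                fsPairing (tupleTwo W x) (B \ insert m (t.image rep)) :=
              mul_le_mul_of_nonneg_left hWle (tupleTree_nonneg h x _)
          _ = φ (t.image rep) := rfl
      -- the pull-back `t ↦ rep(t)` is injective into the `3`-subsets of `S`
      have hinjT : Set.InjOn (fun t : Finset V => t.image rep)
          ↑(((oddSupp x B).erase (x m)).powersetCard 3) := by
        intro t₁ ht₁ t₂ ht₂ he
        have h1 : ∀ b ∈ t₁, b ∈ oddSupp x B := fun b hb =>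
          Finset.mem_of_mem_erase ((Finset.mem_powersetCard.1 (Finset.mem_coe.1 ht₁)).1 hb)
        have h2 : ∀ b ∈ t₂, b ∈ oddSupp x B := fun b hb =>
          Finset.mem_of_mem_erase ((Finset.mem_powersetCard.1 (Finset.mem_coe.1 ht₂)).1 hb)
        have he' : t₁.image rep = t₂.image rep := he
        rw [← hkey t₁ h1, ← hkey t₂ h2, he']
      calc ∑ t ∈ ((oddSupp x B).erase (x m)).powersetCard 3,
            (∑ u, ∏ i ∈ insert (x m) t, W ({i} ∆ {u})) * W (oddSupp x B \ insert (x m) t)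
          ≤ ∑ t ∈ ((oddSupp x B).erase (x m)).powersetCard 3, φ (t.image rep) :=
            Finset.sum_le_sum hle
        _ = ∑ s ∈ (((oddSupp x B).erase (x m)).powersetCard 3).image (fun t => t.image rep), φ s :=
            (Finset.sum_image hinjT).symm
        _ ≤ R := by
            refine Finset.sum_le_sum_of_subset_of_nonneg (fun s hs => ?_) fun s _ _ => hφ0 s
            obtain ⟨t, ht, rfl⟩ := Finset.mem_image.1 hs
            obtain ⟨htY, htcard⟩ := Finset.mem_powersetCard.1 ht
            rw [Finset.mem_powersetCard]
            refine ⟨fun i hi => ?_, ?_⟩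
            · obtain ⟨b, hb, rfl⟩ := Finset.mem_image.1 hi
              exact hrepS b (htY hb)
            · rw [Finset.card_image_of_injOn (fun b₁ h₁ b₂ h₂ he => hinjY b₁
                (Finset.mem_of_mem_erase (htY h₁)) b₂ (Finset.mem_of_mem_erase (htY h₂)) he), htcard]
    -- combine
    rw [← Finset.sum_filter_add_sum_filter_not S (fun j => ∃ j' ∈ S.erase j, x j' = x j) term]
    linarith [hCsum, hNsum, hexc, hrepsum]

/-- **The tree-graph bound on the deviation from Wick's law for families with coincident points,
index-subset form**: if `W` satisfies `TreeWickBounds`, then for every family `x : ι → V` and every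
index set `B` of even size,
`|W(oddSupp x B) - 𝒢[W₂ˣ](B)| ≤ 8 ℛ[Tˣ, W₂ˣ](B)` (`fsPairing`, `fsRemainder` of `TreeGraphWickBound`).
[cite: AizenmanCMP1982, Prop. 12.1 and Prop. 5.3] [cite: Panis2023Triviality, Prop. 4.6 and §4.2] -/
theorem TreeWickBounds.abs_oddSupp_sub_fsPairing_le (h : TreeWickBounds W) (x : ι → V) {B : Finset ι}
    (hB : Even B.card) :
    |W (oddSupp x B) - fsPairing (tupleTwo W x) B| ≤ 8 * fsRemainder (tupleTree W x) (tupleTwo W x) B := by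
  have hup : fsPairing (tupleTwo W x) B - W (oddSupp x B) ≤
      8 * fsRemainder (tupleTree W x) (tupleTwo W x) B :=
    fsPairing_sub_le_of_step (S₂ := tupleTwo W x) (T := tupleTree W x) (S := fun B => W (oddSupp x B))
      (c := 8) (fun _ _ => h.nonneg _)
      (le_of_eq (by show (1 : ℝ) = W (oddSupp x ∅); rw [oddSupp_empty, h.empty]))
      (fun B hB hev => h.excess_tuple x hev (B.min'_mem hB)) B hB
  have hlow := h.oddSupp_le_fsPairing x hB
  have hR0 : 0 ≤ fsRemainder (tupleTree W x) (tupleTwo W x) B :=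
    fsRemainder_nonneg (fun s => tupleTree_nonneg h x s) (fun _ _ => h.nonneg _) B
  rw [abs_sub_le_iff]
  constructor <;> linarith

end Abstract

/-! ### Random-current ratios -/

namespace Current

variable {V : Type*} [Fintype V] [DecidableEq V] {G : SimpleGraph V} [DecidableRel G.Adj]
  {K : G.edgeFinset → ℝ}

/-- **The current ratios `W(A) = Z_K[A]/Z_K[∅]` of edge couplings `K ≥ 0` satisfy `TreeWickBounds`**
(`cratio_empty`, `cratio_nonneg`, `cratio_le_sum`, `gaussianExcess_cratio_le` of `TreeGraphWickBound`,
instantiated at a linear order compatible with the ambient decidable equality). [cite: AizenmanCMP1982, Prop. 12.1 with Prop. 5.3] [cite: Panis2023Triviality, Prop. 4.6 and §4.2] -/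
theorem treeWickBounds_ratio (hK : ∀ e, 0 ≤ K e) :
    TreeWickBounds (fun A : Finset V => wcurrentSum K A / wcurrentSum K ∅) := by
  letI : LinearOrder V := linearOrderOfInjective (Fintype.equivFin V) (Equiv.injective _)
  refine ⟨cratio_empty hK, fun A => cratio_nonneg hK A, fun B v hv => cratio_le_sum hK hv,
    fun B m hm => ?_⟩
  have h := gaussianExcess_cratio_le hK (B := B) hm
  simpa only [ctree, cratio] using h

/-- **The tree-graph bound on the deviation from Wick's law for random-current ratios, all families of
points** (coincidences allowed), in the tree's vocabulary: for edge couplings `K ≥ 0` on a finite simple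
graph, `W(A) = Z_K[A]/Z_K[∅]`, `W₂(a,b) = W({a}Δ{b})` and every `x : Fin (2n) → V`,
`|W(oddSupport x) - 𝒢_n[W₂](x)| ≤ 8 ∑_{|s|=4} T(x_s) 𝒢_{n-2}[W₂](x^{(s̸)})`, `T(u) = ∑_v ∏_j W₂(u_j, v)`
(`pairingSum`, `wickRemainder`). [cite: AizenmanCMP1982, Prop. 12.1 and Prop. 5.3 (p. 37, coincidental points)] [cite: Panis2023Triviality, Prop. 4.6 and §4.2 (tree diagram bound)] -/
theorem abs_ratio_oddSupport_sub_pairingSum_le (hK : ∀ e, 0 ≤ K e) {n : ℕ} (x : Fin (2 * n) → V) :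
    |wcurrentSum K (oddSupport x) / wcurrentSum K ∅ -
        pairingSum (fun a b => wcurrentSum K ({a} ∆ {b}) / wcurrentSum K ∅) n x| ≤
      8 * wickRemainder (fun a b => wcurrentSum K ({a} ∆ {b}) / wcurrentSum K ∅)
        (fun u => ∑ v, ∏ j, wcurrentSum K ({u j} ∆ {v}) / wcurrentSum K ∅) n x := by
  set W : Finset V → ℝ := fun A => wcurrentSum K A / wcurrentSum K ∅ with hW
  have hTW : TreeWickBounds W := treeWickBounds_ratio hK
  have heven : Even (univ : Finset (Fin (2 * n))).card :=
    ⟨n, by rw [Finset.card_univ, Fintype.card_fin]; ring⟩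
  have h := hTW.abs_oddSupp_sub_fsPairing_le x heven
  have hsymm : ∀ a b : V, W ({a} ∆ {b}) = W ({b} ∆ {a}) := fun a b => by rw [symmDiff_comm]
  have hG : fsPairing (tupleTwo W x) univ = pairingSum (fun a b => W ({a} ∆ {b})) n x :=
    fsPairing_univ_eq_pairingSum (fun a b => W ({a} ∆ {b})) hsymm n x
  have hR : fsRemainder (tupleTree W x) (tupleTwo W x) univ =
      wickRemainder (fun a b => W ({a} ∆ {b})) (fun u => ∑ v, ∏ j, W ({u j} ∆ {v})) n x := by
    rw [← fsRemainder_univ_eq_wickRemainder _ hsymm _ n x]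
    refine fsRemainder_congr (fun s hs => ?_) _ _
    rw [dif_pos hs, abs_of_nonneg (Finset.sum_nonneg fun v _ =>
      Finset.prod_nonneg fun j _ => hTW.nonneg _)]
    unfold tupleTree
    refine Finset.sum_congr rfl fun v _ => ?_
    rw [prod_eq_prod_orderEmbOfFin s hs]
    rfl
  rw [hG, hR] at h
  exact h

end Current

/-! ### The free zero-field Ising model on a finite graph and in finite volumes of `ℤ^d` -/

section Ising

variable {V : Type*} [Fintype V] [DecidableEq V] (G : SimpleGraph V) [DecidableRel G.Adj]

/-- **Deviation from Wick's law, tree form, for the free zero-field Ising model with uniform coupling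
`β ≥ 0` on a finite simple graph, all families of points**:
`|⟨∏ᵢσ_{xᵢ}⟩ - 𝒢_n[⟨σσ⟩](x)| ≤ 8 ∑_{|s|=4} (∑_v ∏_{j∈s} ⟨σ_{x_j}σ_v⟩) 𝒢_{n-2}[⟨σσ⟩](x^{(s̸)})`
(random-current representation `⟨σ_A⟩ = Z[A]/Z[∅]`, `⟨∏σ_{xᵢ}⟩ = ⟨σ_{oddSupport x}⟩`).
[cite: AizenmanCMP1982, Prop. 12.1 and Prop. 5.3] [cite: Panis2023Triviality, Prop. 4.6 and §4.2] -/
theorem abs_nPoint_sub_pairingSum_le_univ_free {β : ℝ} (hβ : 0 ≤ β) {n : ℕ} (x : Fin (2 * n) → V) :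
    |nPoint (isingMeasure G univ β 0 .free) spinAt x -
        pairingSum (twoPoint (isingMeasure G univ β 0 .free) spinAt) n x| ≤
      8 * wickRemainder (twoPoint (isingMeasure G univ β 0 .free) spinAt)
        (fun u => ∑ v, ∏ j, twoPoint (isingMeasure G univ β 0 .free) spinAt (u j) v) n x := by
  have hK : ∀ e : G.edgeFinset, 0 ≤ (fun _ : G.edgeFinset => β) e := fun _ => hβ
  have h := Current.abs_ratio_oddSupport_sub_pairingSum_le (K := fun _ : G.edgeFinset => β) hK x
  have hN : nPoint (isingMeasure G univ β 0 .free) spinAt x =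
      wcurrentSum (fun _ : G.edgeFinset => β) (oddSupport x) /
        wcurrentSum (fun _ : G.edgeFinset => β) ∅ := by
    rw [nPoint_univ_free_eq_isingCorr, isingCorr_free_eq_currentSum_div_holds G β,
      currentSum_eq_wcurrentSum, currentSum_eq_wcurrentSum]
  have h2f : twoPoint (isingMeasure G univ β 0 .free) spinAt =
      fun a b => wcurrentSum (fun _ : G.edgeFinset => β) ({a} ∆ {b}) /
        wcurrentSum (fun _ : G.edgeFinset => β) ∅ := by
    funext a b
    rw [twoPoint_isingMeasure, isingTwoPoint_free_eq_currentSum_div_holds G β a b,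
      currentSum_eq_wcurrentSum, currentSum_eq_wcurrentSum]
  rw [hN, h2f]
  exact h

/-- **The same in a finite volume `Λ ⊂ ℤ^d`** (free boundary condition, zero field, `β ≥ 0`,
`x₁,…,x_{2n} ∈ Λ`), with the tree diagram summed over `Λ`:
`|⟨∏ᵢσ_{xᵢ}⟩_Λ - 𝒢_n[⟨σσ⟩_Λ](x)| ≤ 8 ∑_{|s|=4} (∑_{v∈Λ} ∏_{j∈s} ⟨σ_{x_j}σ_v⟩_Λ) 𝒢_{n-2}[⟨σσ⟩_Λ](x^{(s̸)})`
(the free measure of `Λ` is the Ising model of the induced graph, `isingExpect_free_map`).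
[cite: AizenmanCMP1982, Prop. 12.1 and Prop. 5.3] [cite: Panis2023Triviality, Prop. 4.6 and §4.2] -/
theorem abs_nPoint_sub_pairingSum_le_box {d : ℕ} (Λ : Finset (Site d)) {β : ℝ} (hβ : 0 ≤ β) {n : ℕ}
    (x : Fin (2 * n) → Site d) (hx : ∀ i, x i ∈ Λ) :
    |nPoint (isingMeasure (zdGraph d) Λ β 0 .free) spinAt x -
        pairingSum (twoPoint (isingMeasure (zdGraph d) Λ β 0 .free) spinAt) n x| ≤
      8 * wickRemainder (twoPoint (isingMeasure (zdGraph d) Λ β 0 .free) spinAt)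
        (fun u => ∑ v ∈ Λ, ∏ j, twoPoint (isingMeasure (zdGraph d) Λ β 0 .free) spinAt (u j) v)
          n x := by
  classical
  -- the graph induced on `Λ`, on the vertex type `↥Λ`
  set ι : ↥Λ ↪ Site d := Function.Embedding.subtype (· ∈ Λ) with hι
  set GΛ : SimpleGraph ↥Λ := (zdGraph d).comap ι with hGΛ
  set x' : Fin (2 * n) → ↥Λ := fun i => ⟨x i, hx i⟩ with hx'
  have hmap : (univ : Finset ↥Λ).map ι = Λ := by
    rw [hι, Finset.univ_eq_attach, Finset.attach_map_val]
  have hadj : ∀ a ∈ (univ : Finset ↥Λ), ∀ b ∈ (univ : Finset ↥Λ),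
      ((zdGraph d).Adj (ι a) (ι b) ↔ GΛ.Adj a b) := fun _ _ _ _ => Iff.rfl
  -- transport of the expectations of spin monomials
  have hE : ∀ {m : ℕ} (y : Fin m → ↥Λ),
      nPoint (isingMeasure (zdGraph d) Λ β 0 .free) spinAt (fun i => (y i : Site d)) =
        nPoint (isingMeasure GΛ univ β 0 .free) spinAt y := by
    intro m y
    have key := isingExpect_free_map (G := GΛ) (G' := zdGraph d) ι (Λ := univ) hadj β 0
      (measurable_spinMonomial fun i => (y i : Site d))
    rw [hmap] at key
    change isingExpect (zdGraph d) Λ β 0 .free (spinMonomial fun i => (y i : Site d)) =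
      isingExpect GΛ univ β 0 .free (spinMonomial y)
    rw [key]
    congr 1
    funext σ
    simp only [spinMonomial]
    exact Finset.prod_congr rfl fun i _ => spinAt_extendAlong ι σ (y i)
  have hN : nPoint (isingMeasure (zdGraph d) Λ β 0 .free) spinAt x =
      nPoint (isingMeasure GΛ univ β 0 .free) spinAt x' := hE x'
  have h2pt : ∀ a b : ↥Λ, twoPoint (isingMeasure (zdGraph d) Λ β 0 .free) spinAt (a : Site d) b =
      twoPoint (isingMeasure GΛ univ β 0 .free) spinAt a b := by
    intro a b
    rw [twoPoint_eq_nPoint, twoPoint_eq_nPoint]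
    have := hE ![a, b]
    refine Eq.trans ?_ this
    congr 1
    funext l
    fin_cases l <;> rfl
  have h2 : ∀ i j, twoPoint (isingMeasure (zdGraph d) Λ β 0 .free) spinAt (x i) (x j) =
      twoPoint (isingMeasure GΛ univ β 0 .free) spinAt (x' i) (x' j) := fun i j => h2pt (x' i) (x' j)
  have hT : ∀ e : Fin 4 → Fin (2 * n),
      ∑ v ∈ Λ, ∏ j, twoPoint (isingMeasure (zdGraph d) Λ β 0 .free) spinAt (x (e j)) v =
        ∑ v, ∏ j, twoPoint (isingMeasure GΛ univ β 0 .free) spinAt (x' (e j)) v := by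
    intro e
    rw [← Finset.sum_coe_sort Λ]
    refine Finset.sum_congr rfl fun v _ => Finset.prod_congr rfl fun j _ => ?_
    exact h2pt (x' (e j)) v
  rw [hN, pairingSum_congr_of_eq _ _ n x x' h2,
    wickRemainder_congr_of_eq _ _
      (fun u => ∑ v ∈ Λ, ∏ j, twoPoint (isingMeasure (zdGraph d) Λ β 0 .free) spinAt (u j) v)
      (fun u => ∑ v, ∏ j, twoPoint (isingMeasure GΛ univ β 0 .free) spinAt (u j) v)
      n x x' h2 (fun e => hT e)]
  exact abs_nPoint_sub_pairingSum_le_univ_free GΛ hβ x'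

end Ising

end Literature.Probability.LatticeModels

end
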